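import Literature.MathematicalPhysics.StatisticalMechanics.ComplexSpinTwoPointThermodynamicLimit
import HarnessLib

/-!
# The infrared bound in the thermodynamic limit (Salmhofer–Seiler, CMP 139 (1991), Thm. 3.21 and
# Thm. 3.23 (1) (3.109): "taking the thermodynamic limit in the infrared bound")

Companion of `ComplexSpinInfraredBoundProof` (Thm. 3.21 on every even torus: the second-order
Gaussian-domination bounds `[σ(-Δφ)²]_Λ ≤ N⁻¹(φ,-Δφ)Z_Λ`, `[σ(Δ̄φ)²]_Λ ≥ -N⁻¹(φ,Δ̄φ)Z_Λ`,
`bracket_sq_field_stencil_negOne_le` / `neg_le_bracket_sq_field_stencil_one`) and of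
`ComplexSpinTwoPointThermodynamicLimit` (Thm. 3.23 (1) in lattice form).  Salmhofer–Seiler state the
density bounds (3.109) on the absolutely continuous part `ĝ` of `T̂ = lim T̂_Λ` and prove them by
"taking the thermodynamic limit in the infrared bound and using a peaking argument, as in [18]"
(p. 417).  This file proves the infinite-volume infrared bound itself, in position space, for every
pointwise thermodynamic limit `T(x) = lim_n T_{Λ_n}(x)` of the two-point function along even tori
`Λ_n → ∞` and every finitely supported test configuration `φ : ℤ^ν → ℝ`:

* **`thermodynamicLimit_infraredBound`** (`b_k ≥ 0`; `_of_hasLog` under Thm. 3.18's hypotheses;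
  `uN_…` for the `U(N)` model, `N ≤ 4`):
  `∑_{x,y} (-Δφ)(x) T(y - x) (-Δφ)(y) ≤ N⁻¹ (φ, -Δφ)` and
  `∑_{x,y} (Δ̄φ)(x) T(y - x) (Δ̄φ)(y) ≥ -N⁻¹ (φ, Δ̄φ)` —
  (3.74)/(3.75) to second order, i.e. (3.112) `2T̂ D ≤ N⁻¹`, `2T̂ D̄ ≥ -N⁻¹` for the limit `T̂` as a
  measure: the content of (3.109) (and of the one-sidedness of the atoms) without naming `ĝ`.

The passage to the limit is elementary once a finitely supported `φ` is read on a large torus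
(`torusCfg`: `φ_L(ξ) = ∑_{x̄ = ξ} φ(x)`): for `L` so large that the projection is injective on the
second neighbourhood of the support (`nbhd`), the torus stencils and quadratic forms coincide with
the lattice ones (`stencil_torusCfg_proj`, `sum_torusCfg_mul_stencil`, `sum_stencil_twoPoint_eq`),
the finite-volume bound reads `infraredBound_torusCfg`, and finitely many pointwise limits are taken.
Honest framing: `β = 0` complex spin systems on even tori and their pointwise limits; nothing about
`β > 0`, the continuum, `SU(N)` or the summit's `QCD` conjunct.

WHAT IS PRINTED (locators).  Thm. 3.21 (3.74)–(3.75) p. 413; (3.109), (3.112) p. 416; "Inequality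
(3.109) follows by taking the thermodynamic limit in the infrared bound and using a peaking argument,
as in [18]" p. 417.

## References

* M. Salmhofer, E. Seiler, *Proof of chiral symmetry breaking in strongly coupled lattice gauge
  theory*, Commun. Math. Phys. 139 (1991) 395–432: Thm. 3.21, Thm. 3.23 (1). [SalmhoferSeiler1991]
* J. Fröhlich, B. Simon, T. Spencer, Commun. Math. Phys. 50 (1976) 79–95 ([18]). [FrohlichSimonSpencer1976]
-/

noncomputable section

namespace Literature.MathematicalPhysics.StatisticalMechanics

namespace ComplexSpin

open MvPolynomial Finset Filter Topology
open Literature.Probability.LatticeModels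

variable {ν : ℕ}

/-! ### The stencils `-Δ`, `Δ̄` on `ℤ^ν` and the neighbourhood of a finite set -/

/-- The nearest-neighbour stencil on `ℤ^ν`: `(T_s φ)(x) = ∑_μ (2φ(x) + s(φ(x+e_μ) + φ(x-e_μ)))`,
`T_{-1} = -Δ`, `T_1 = Δ̄` ((3.76), on the infinite lattice). [cite: SalmhoferSeiler1991, (3.76)] -/
def latStencil (s : ℝ) (φ : Site ν → ℝ) (x : Site ν) : ℝ :=
  ∑ μ : Fin ν, (2 * φ x + s * (φ (x + Pi.single μ 1) + φ (x - Pi.single μ 1)))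

/-- The set `S` together with its nearest neighbours. [cite: SalmhoferSeiler1991, (3.76)] -/
def nbhd (S : Finset (Site ν)) : Finset (Site ν) :=
  S ∪ (S ×ˢ (Finset.univ : Finset (Fin ν))).image (fun p => p.1 + Pi.single p.2 1) ∪
    (S ×ˢ (Finset.univ : Finset (Fin ν))).image (fun p => p.1 - Pi.single p.2 1)

/-- `S ⊆ nbhd S`. [cite: SalmhoferSeiler1991, (3.76)] -/
theorem subset_nbhd (S : Finset (Site ν)) : S ⊆ nbhd S := fun x hx => by
  unfold nbhd; exact Finset.mem_union_left _ (Finset.mem_union_left _ hx)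

/-- `x + e_μ ∈ nbhd S` for `x ∈ S`. [cite: SalmhoferSeiler1991, (3.76)] -/
theorem add_single_mem_nbhd {S : Finset (Site ν)} {x : Site ν} (hx : x ∈ S) (μ : Fin ν) :
    x + Pi.single μ 1 ∈ nbhd S := by
  unfold nbhd
  refine Finset.mem_union_left _ (Finset.mem_union_right _ ?_)
  exact Finset.mem_image.2 ⟨(x, μ), Finset.mem_product.2 ⟨hx, Finset.mem_univ _⟩, rfl⟩

/-- `x - e_μ ∈ nbhd S` for `x ∈ S`. [cite: SalmhoferSeiler1991, (3.76)] -/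
theorem sub_single_mem_nbhd {S : Finset (Site ν)} {x : Site ν} (hx : x ∈ S) (μ : Fin ν) :
    x - Pi.single μ 1 ∈ nbhd S := by
  unfold nbhd
  refine Finset.mem_union_right _ ?_
  exact Finset.mem_image.2 ⟨(x, μ), Finset.mem_product.2 ⟨hx, Finset.mem_univ _⟩, rfl⟩

/-- The stencil of a function supported in `S` is supported in `nbhd S`. [cite: SalmhoferSeiler1991, (3.76)] -/
theorem latStencil_eq_zero_of_not_mem {S : Finset (Site ν)} {φ : Site ν → ℝ}
    (hφ : ∀ x, x ∉ S → φ x = 0) (s : ℝ) {x : Site ν} (hx : x ∉ nbhd S) : latStencil s φ x = 0 := by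
  have h0 : φ x = 0 := hφ x fun h => hx (subset_nbhd S h)
  have h1 : ∀ μ, φ (x + Pi.single μ 1) = 0 := fun μ => hφ _ fun h => hx (by
    have := sub_single_mem_nbhd h μ; rwa [add_sub_cancel_right] at this)
  have h2 : ∀ μ, φ (x - Pi.single μ 1) = 0 := fun μ => hφ _ fun h => hx (by
    have := add_single_mem_nbhd h μ; rwa [sub_add_cancel] at this)
  unfold latStencil
  simp [h0, h1, h2]

/-! ### Reading a finitely supported configuration on a large torus -/

/-- `Torus.proj` is additive. [folklore] -/
private theorem proj_add (L : ℕ) (x y : Site ν) : Torus.proj L (x + y) = Torus.proj L x + Torus.proj L y := by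
  funext i; simp [Torus.proj]

/-- `Torus.proj` respects subtraction. [folklore] -/
private theorem proj_sub (L : ℕ) (x y : Site ν) : Torus.proj L (x - y) = Torus.proj L x - Torus.proj L y := by
  funext i; simp [Torus.proj]

/-- `Torus.proj e_μ = e_μ`. [folklore] -/
private theorem proj_single (L : ℕ) (μ : Fin ν) :
    Torus.proj L (Pi.single μ (1 : ℤ)) = Pi.single μ (1 : ZMod L) := by
  funext i
  by_cases h : i = μ
  · subst h; simp [Torus.proj]
  · simp [Torus.proj, Pi.single_eq_of_ne h]

/-- Two sites of `ℤ^ν` with the same image on `(ℤ/L)^ν` and all coordinates `< L/2` in absolute value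
coincide. [folklore] -/
private theorem eq_of_proj_eq' {L : ℕ} {x y : Site ν} (hx : ∀ i, |x i| < L / 2) (hy : ∀ i, |y i| < L / 2)
    (h : Torus.proj L x = Torus.proj L y) : x = y := by
  funext i
  have hi : ((x i : ℤ) : ZMod L) = ((y i : ℤ) : ZMod L) := congrFun h i
  rw [ZMod.intCast_eq_intCast_iff_dvd_sub] at hi
  obtain ⟨k, hk⟩ := hi
  have hxi := hx i
  have hyi := hy i
  rw [abs_lt] at hxi hyi
  have hL2 : ((L / 2 : ℕ) : ℤ) ≤ (L : ℤ) / 2 := by omega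
  have hb : |y i - x i| < L := by
    rw [abs_lt]; constructor <;> omega
  rw [hk, abs_mul, Nat.abs_cast] at hb
  rcases eq_or_ne k 0 with hk0 | hk0
  · rw [hk0, mul_zero] at hk; omega
  · have : (L : ℤ) * 1 ≤ (L : ℤ) * |k| :=
      mul_le_mul_of_nonneg_left (Int.one_le_abs hk0) (by positivity)
    omega

/-- The projection to a large torus is injective on any finite set. [folklore] -/
private theorem exists_injOn_proj' (B : Finset (Site ν)) :
    ∃ L₀ : ℕ, ∀ L : ℕ, L₀ ≤ L → Set.InjOn (Torus.proj L) (B : Set (Site ν)) := by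
  classical
  obtain ⟨M, hM⟩ : ∃ M : ℕ, ∀ x ∈ B, ∀ i, |x i| < M := by
    refine ⟨(B.sup fun x => Finset.univ.sup fun i => (x i).natAbs) + 1, fun x hx i => ?_⟩
    have h1 : (x i).natAbs ≤ Finset.univ.sup fun i => (x i).natAbs :=
      Finset.le_sup (f := fun i => (x i).natAbs) (Finset.mem_univ i)
    have h2 : (Finset.univ.sup fun i => (x i).natAbs) ≤ B.sup fun x => Finset.univ.sup fun i => (x i).natAbs :=
      Finset.le_sup (f := fun x => Finset.univ.sup fun i => (x i).natAbs) hx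
    have h3 : (x i).natAbs < (B.sup fun x => Finset.univ.sup fun i => (x i).natAbs) + 1 := by omega
    rw [Int.abs_eq_natAbs]
    exact_mod_cast h3
  refine ⟨2 * M + 2, fun L hL x hx y hy hxy => ?_⟩
  refine eq_of_proj_eq' (L := L) (fun i => ?_) (fun i => ?_) hxy
  · have := hM x hx i
    have : (M : ℤ) ≤ ((L / 2 : ℕ) : ℤ) := by exact_mod_cast (by omega : M ≤ L / 2)
    omega
  · have := hM y hy i
    have : (M : ℤ) ≤ ((L / 2 : ℕ) : ℤ) := by exact_mod_cast (by omega : M ≤ L / 2)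
    omega

section Torus

variable {L : ℕ}

/-- The configuration `φ` (supported in `S`) read on the torus: `φ_L(ξ) = ∑_{x ∈ S, x̄ = ξ} φ(x)`.
[cite: SalmhoferSeiler1991, Thm. 3.21 (φ : Λ → ℝ)] -/
def torusCfg (S : Finset (Site ν)) (φ : Site ν → ℝ) (ξ : TorusSite ν L) : ℝ :=
  ∑ x ∈ S, if Torus.proj L x = ξ then φ x else 0

/-- On a torus so large that `proj` is injective on a set `B ⊇ S`, `φ_L(x̄) = φ(x)` for all `x ∈ B`.
[cite: SalmhoferSeiler1991, Thm. 3.21] -/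
theorem torusCfg_proj {S B : Finset (Site ν)} (hSB : S ⊆ B) {φ : Site ν → ℝ}
    (hφ : ∀ x, x ∉ S → φ x = 0) (hinj : Set.InjOn (Torus.proj L) (B : Set (Site ν)))
    {x : Site ν} (hx : x ∈ B) : torusCfg (L := L) S φ (Torus.proj L x) = φ x := by
  classical
  unfold torusCfg
  by_cases hxS : x ∈ S
  · rw [Finset.sum_eq_single x]
    · rw [if_pos rfl]
    · intro y hy hyx
      rw [if_neg]
      exact fun h => hyx (hinj (hSB hy) hx h)
    · exact fun h => absurd hxS h
  · rw [hφ x hxS]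
    refine Finset.sum_eq_zero fun y hy => ?_
    rw [if_neg]
    intro h
    exact hxS (hinj (hSB hy) hx h ▸ hy)

/-- `φ_L` vanishes off the image of `S`. [cite: SalmhoferSeiler1991, Thm. 3.21] -/
theorem torusCfg_eq_zero {S : Finset (Site ν)} {φ : Site ν → ℝ} {ξ : TorusSite ν L}
    (hξ : ∀ x ∈ S, Torus.proj L x ≠ ξ) : torusCfg (L := L) S φ ξ = 0 := by
  unfold torusCfg
  exact Finset.sum_eq_zero fun x hx => if_neg (hξ x hx)

/-- On a large torus the torus stencil of `φ_L` is the lattice stencil of `φ`: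
`(T_s φ_L)(x̄) = (T_s φ)(x)` for `x ∈ nbhd S`. [cite: SalmhoferSeiler1991, (3.76)] -/
theorem stencil_torusCfg_proj {S : Finset (Site ν)} {φ : Site ν → ℝ} (hφ : ∀ x, x ∉ S → φ x = 0)
    (hinj : Set.InjOn (Torus.proj L) (nbhd (nbhd S) : Set (Site ν))) (s : ℝ) {x : Site ν}
    (hx : x ∈ nbhd S) :
    stencil s (torusCfg (L := L) S φ) (Torus.proj L x) = latStencil s φ x := by
  have hSB : S ⊆ nbhd (nbhd S) := (subset_nbhd S).trans (subset_nbhd _)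
  unfold stencil latStencil
  refine Finset.sum_congr rfl fun μ _ => ?_
  rw [← proj_single L μ, ← proj_add, ← proj_sub, torusCfg_proj hSB hφ hinj (subset_nbhd _ hx),
    torusCfg_proj hSB hφ hinj (add_single_mem_nbhd hx μ),
    torusCfg_proj hSB hφ hinj (sub_single_mem_nbhd hx μ)]

/-- Off the image of `nbhd S` the torus stencil of `φ_L` vanishes. [cite: SalmhoferSeiler1991, (3.76)] -/
theorem stencil_torusCfg_eq_zero {S : Finset (Site ν)} {φ : Site ν → ℝ} (s : ℝ) {ξ : TorusSite ν L}
    (hξ : ∀ x ∈ nbhd S, Torus.proj L x ≠ ξ) : stencil s (torusCfg (L := L) S φ) ξ = 0 := by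
  have h0 : torusCfg (L := L) S φ ξ = 0 :=
    torusCfg_eq_zero fun x hx => hξ x (subset_nbhd S hx)
  have h1 : ∀ μ : Fin ν, torusCfg (L := L) S φ (ξ + Pi.single μ 1) = 0 := by
    intro μ
    refine torusCfg_eq_zero fun x hx h => hξ (x - Pi.single μ 1) (sub_single_mem_nbhd hx μ) ?_
    rw [proj_sub, proj_single, h, add_sub_cancel_right]
  have h2 : ∀ μ : Fin ν, torusCfg (L := L) S φ (ξ - Pi.single μ 1) = 0 := by
    intro μ
    refine torusCfg_eq_zero fun x hx h => hξ (x + Pi.single μ 1) (add_single_mem_nbhd hx μ) ?_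
    rw [proj_add, proj_single, h, sub_add_cancel]
  unfold stencil
  simp [h0, h1, h2]

variable [NeZero L]

/-- A torus sum of a function vanishing off the injective image of a finite set `B ⊂ ℤ^ν` is the
sum over `B`. [folklore] -/
private theorem sum_torus_eq_sum_of_support {B : Finset (Site ν)} (hinj : Set.InjOn (Torus.proj L) (B : Set (Site ν)))
    {F : TorusSite ν L → ℝ} (hF : ∀ ξ, (∀ x ∈ B, Torus.proj L x ≠ ξ) → F ξ = 0) :
    ∑ ξ : TorusSite ν L, F ξ = ∑ x ∈ B, F (Torus.proj L x) := by
  classical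
  rw [← Finset.sum_image (f := F) (s := B) (g := Torus.proj L) fun x hx y hy h => hinj hx hy h]
  refine (Finset.sum_subset (Finset.subset_univ _) fun ξ _ hξ => hF ξ fun x hx h => hξ ?_).symm
  exact Finset.mem_image.2 ⟨x, hx, h⟩

/-- **The quadratic form `(φ, T_s φ)` read on a large torus equals the lattice one.**
[cite: SalmhoferSeiler1991, (3.76)–(3.77)] -/
theorem sum_torusCfg_mul_stencil {S : Finset (Site ν)} {φ : Site ν → ℝ} (hφ : ∀ x, x ∉ S → φ x = 0)
    (hinj : Set.InjOn (Torus.proj L) (nbhd (nbhd S) : Set (Site ν))) (s : ℝ) :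
    ∑ ξ : TorusSite ν L, torusCfg (L := L) S φ ξ * stencil s (torusCfg (L := L) S φ) ξ =
      ∑ x ∈ S, φ x * latStencil s φ x := by
  have hSB : S ⊆ nbhd (nbhd S) := (subset_nbhd S).trans (subset_nbhd _)
  have hinjS : Set.InjOn (Torus.proj L) (S : Set (Site ν)) := hinj.mono (by exact_mod_cast hSB)
  rw [sum_torus_eq_sum_of_support hinjS (F := fun ξ => torusCfg (L := L) S φ ξ *
    stencil s (torusCfg (L := L) S φ) ξ) fun ξ hξ => by rw [torusCfg_eq_zero hξ, zero_mul]]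
  refine Finset.sum_congr rfl fun x hx => ?_
  rw [torusCfg_proj hSB hφ hinj (hSB hx), stencil_torusCfg_proj hφ hinj s (subset_nbhd S hx)]

/-- **The two-point form `∑_{ξ,ζ} (T_sφ_L)(ξ) ⟨σ_ξσ_ζ⟩_Λ (T_sφ_L)(ζ)` read on a large torus** equals
`∑_{x,y ∈ nbhd S} (T_sφ)(x) T_Λ(ȳ - x̄) (T_sφ)(y)`. [cite: SalmhoferSeiler1991, (3.77) and (3.100)] -/
theorem sum_stencil_twoPoint_eq {S : Finset (Site ν)} {φ : Site ν → ℝ} (hφ : ∀ x, x ∉ S → φ x = 0)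
    (hinj : Set.InjOn (Torus.proj L) (nbhd (nbhd S) : Set (Site ν))) (s : ℝ) (N : ℕ) (m : ℝ)
    (a : ℕ → ℝ) :
    ∑ ξ : TorusSite ν L, ∑ ζ : TorusSite ν L, stencil s (torusCfg (L := L) S φ) ξ *
        expect N m a (X ξ * X ζ) * stencil s (torusCfg (L := L) S φ) ζ =
      ∑ x ∈ nbhd S, ∑ y ∈ nbhd S, latStencil s φ x *
        corrFn (L := L) N m a (Torus.proj L (y - x)) * latStencil s φ y := by
  have hinj1 : Set.InjOn (Torus.proj L) (nbhd S : Set (Site ν)) :=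
    hinj.mono (by exact_mod_cast subset_nbhd (nbhd S))
  have hcorr : ∀ ξ ζ : TorusSite ν L, expect N m a (X ξ * X ζ) = corrFn (L := L) N m a (ζ - ξ) := by
    intro ξ ζ
    rw [corrFn, expect_eq_div, expect_eq_div]
    congr 1
    have := bracket_X_mul_X_add N m a 0 (ζ - ξ) ξ
    rw [zero_add, sub_add_cancel] at this
    exact this
  rw [sum_torus_eq_sum_of_support hinj1 (F := fun ξ => ∑ ζ : TorusSite ν L,
    stencil s (torusCfg (L := L) S φ) ξ * expect N m a (X ξ * X ζ) * stencil s (torusCfg (L := L) S φ) ζ)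
    fun ξ hξ => by simp [stencil_torusCfg_eq_zero s hξ]]
  refine Finset.sum_congr rfl fun x hx => ?_
  rw [sum_torus_eq_sum_of_support hinj1 (F := fun ζ =>
    stencil s (torusCfg (L := L) S φ) (Torus.proj L x) * expect N m a (X (Torus.proj L x) * X ζ) *
      stencil s (torusCfg (L := L) S φ) ζ) fun ζ hζ => by simp [stencil_torusCfg_eq_zero s hζ]]
  refine Finset.sum_congr rfl fun y hy => ?_
  rw [stencil_torusCfg_proj hφ hinj s hx, stencil_torusCfg_proj hφ hinj s hy, hcorr, ← proj_sub]

/-- **Thm. 3.21 on the torus, normalised, for a configuration read from `ℤ^ν`** (both signs):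
`∑_{x,y} (T_{-1}φ)(x) T_Λ(ȳ-x̄) (T_{-1}φ)(y) ≤ N⁻¹ (φ, T_{-1}φ)` and
`-N⁻¹ (φ, T_1φ) ≤ ∑_{x,y} (T_1φ)(x) T_Λ(ȳ-x̄) (T_1φ)(y)`, for every large even torus.
[cite: SalmhoferSeiler1991, Thm. 3.21 (3.74)–(3.75)] -/
theorem infraredBound_torusCfg (hL : Even L) (i : Fin ν) (hcard : 2 ≤ Fintype.card (TorusSite ν L))
    {N : ℕ} (hN : 1 ≤ N) (m : ℝ) {a : ℕ → ℝ} (hb : ∀ k ≤ N, 0 ≤ fluctCoeff N a k)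
    {S : Finset (Site ν)} {φ : Site ν → ℝ} (hφ : ∀ x, x ∉ S → φ x = 0)
    (hinj : Set.InjOn (Torus.proj L) (nbhd (nbhd S) : Set (Site ν))) :
    (∑ x ∈ nbhd S, ∑ y ∈ nbhd S, latStencil (-1) φ x *
        corrFn (L := L) N m a (Torus.proj L (y - x)) * latStencil (-1) φ y ≤
      1 / N * ∑ x ∈ S, φ x * latStencil (-1) φ x) ∧
    (-(1 / N * ∑ x ∈ S, φ x * latStencil 1 φ x) ≤
      ∑ x ∈ nbhd S, ∑ y ∈ nbhd S, latStencil 1 φ x *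
        corrFn (L := L) N m a (Torus.proj L (y - x)) * latStencil 1 φ y) := by
  have hNpos : (0 : ℝ) < N := by exact_mod_cast hN
  set ψ := torusCfg (L := L) S φ with hψ
  have hZ0 : 0 ≤ partitionFunction (ν := ν) (L := L) N m a :=
    (partitionFunction_nonneg' hL i hcard 1 (Or.inl rfl) m hb).1
  set Z := partitionFunction (ν := ν) (L := L) N m a with hZdef
  -- the quadratic forms are nonnegative
  have hQ : ∀ s : ℝ, s = 1 ∨ s = -1 → 0 ≤ ∑ ξ : TorusSite ν L, ψ ξ * stencil s ψ ξ := by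
    intro s hs; rw [← sum_sq_link_eq s hs ψ]; positivity
  -- the two-point form through the bracket
  have hform : ∀ s : ℝ, ∑ ξ : TorusSite ν L, ∑ ζ : TorusSite ν L,
      stencil s ψ ξ * expect N m a (X ξ * X ζ) * stencil s ψ ζ =
      bracket N m a (field (stencil s ψ) ^ 2) / Z := by
    intro s
    rw [sq, bracket_field_mul_field, Finset.sum_div]
    refine Finset.sum_congr rfl fun ξ _ => ?_
    rw [Finset.sum_div]
    refine Finset.sum_congr rfl fun ζ _ => ?_
    rw [expect_eq_div]
    ring
  constructor
  · rw [← sum_stencil_twoPoint_eq hφ hinj (-1) N m a, ← sum_torusCfg_mul_stencil hφ hinj (-1), hform]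
    have h := bracket_sq_field_stencil_negOne_le hL i hcard hN m hb ψ
    rcases hZ0.eq_or_lt with hZ | hZ
    · rw [← hZ, div_zero]
      exact mul_nonneg (by positivity) (hQ (-1) (Or.inr rfl))
    · rw [div_le_iff₀ hZ]; exact h
  · rw [← sum_stencil_twoPoint_eq hφ hinj 1 N m a, ← sum_torusCfg_mul_stencil hφ hinj 1, hform]
    have h := neg_le_bracket_sq_field_stencil_one hL i hcard hN m hb ψ
    rcases hZ0.eq_or_lt with hZ | hZ
    · rw [← hZ, div_zero, neg_nonpos]
      exact mul_nonneg (by positivity) (hQ 1 (Or.inl rfl))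
    · rw [le_div_iff₀ hZ, neg_mul]; exact h

end Torus

/-! ### Theorem 3.21 in the thermodynamic limit -/

/-- **The infrared bound in the thermodynamic limit (Thm. 3.21 for the infinite-volume two-point
function; the lattice form of (3.109)).**  Let `ν ≥ 1`, `N ≥ 1`, `b_k ≥ 0` (`k ≤ N`), and let `T` be a
pointwise thermodynamic limit of the two-point function `T_Λ(x) = ⟨σ₀σ_x⟩_Λ` along even tori
`Λ_n = (ℤ/L_n)^ν → ∞`.  Then for every finitely supported `φ : ℤ^ν → ℝ` (support in `S`):
`∑_{x,y} (-Δφ)(x) T(y-x) (-Δφ)(y) ≤ N⁻¹ (φ, -Δφ)` and `∑_{x,y} (Δ̄φ)(x) T(y-x) (Δ̄φ)(y) ≥ -N⁻¹ (φ, Δ̄φ)`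
— (3.74)/(3.75) to second order for the infinite-volume state, i.e. in Fourier space
`2T̂(k)D(k) ≤ N⁻¹` and `2T̂(k)D(k+π̂) ≥ -N⁻¹` as measures ((3.112) in the limit), which is the density
bound (3.109) on `ĝ` together with the compatibility of the atoms ("Inequality (3.109) follows by
taking the thermodynamic limit in the infrared bound", p. 417).
[cite: SalmhoferSeiler1991, Thm. 3.21 (3.74)–(3.75) and Thm. 3.23 (1) (3.109)] -/
theorem thermodynamicLimit_infraredBound (hν : 1 ≤ ν) {N : ℕ} (hN : 1 ≤ N) {m : ℝ} {a : ℕ → ℝ}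
    (hb : ∀ k ≤ N, 0 ≤ fluctCoeff N a k) (Ls : ℕ → ℕ) [∀ n, NeZero (Ls n)]
    (hev : ∀ n, Even (Ls n)) (hLs : Tendsto Ls atTop atTop) {T : Site ν → ℝ}
    (hT : ∀ x, Tendsto (fun n => corrFn (L := Ls n) N m a (Torus.proj (Ls n) x)) atTop (nhds (T x)))
    (S : Finset (Site ν)) (φ : Site ν → ℝ) (hφ : ∀ x, x ∉ S → φ x = 0) :
    (∑ x ∈ nbhd S, ∑ y ∈ nbhd S, latStencil (-1) φ x * T (y - x) * latStencil (-1) φ y ≤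
      1 / N * ∑ x ∈ S, φ x * latStencil (-1) φ x) ∧
    (-(1 / N * ∑ x ∈ S, φ x * latStencil 1 φ x) ≤
      ∑ x ∈ nbhd S, ∑ y ∈ nbhd S, latStencil 1 φ x * T (y - x) * latStencil 1 φ y) := by
  obtain ⟨L₁, hL₁⟩ := exists_injOn_proj' (nbhd (nbhd S))
  have hevn : ∀ᶠ n in atTop, L₁ ≤ Ls n ∧ 2 ≤ Ls n := by
    filter_upwards [hLs.eventually_ge_atTop (max L₁ 2)] with n hn
    exact ⟨le_trans (le_max_left _ _) hn, le_trans (le_max_right _ _) hn⟩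
  have hcard : ∀ n, 2 ≤ Ls n → 2 ≤ Fintype.card (TorusSite ν (Ls n)) := by
    intro n hn
    rw [card_torusSite]
    calc 2 ≤ Ls n := hn
      _ = Ls n ^ 1 := (pow_one _).symm
      _ ≤ Ls n ^ ν := Nat.pow_le_pow_right (by omega) hν
  have hlim : ∀ s : ℝ, Tendsto (fun n => ∑ x ∈ nbhd S, ∑ y ∈ nbhd S, latStencil s φ x *
      corrFn (L := Ls n) N m a (Torus.proj (Ls n) (y - x)) * latStencil s φ y) atTop
      (nhds (∑ x ∈ nbhd S, ∑ y ∈ nbhd S, latStencil s φ x * T (y - x) * latStencil s φ y)) := by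
    intro s
    refine tendsto_finsetSum _ fun x _ => tendsto_finsetSum _ fun y _ => ?_
    exact ((hT (y - x)).const_mul _).mul_const _
  constructor
  · refine le_of_tendsto (hlim (-1)) ?_
    filter_upwards [hevn] with n hn
    exact (infraredBound_torusCfg (hev n) ⟨0, hν⟩ (hcard n hn.2) hN m hb hφ (hL₁ (Ls n) hn.1)).1
  · refine ge_of_tendsto (hlim 1) ?_
    filter_upwards [hevn] with n hn
    exact (infraredBound_torusCfg (hev n) ⟨0, hν⟩ (hcard n hn.2) hN m hb hφ (hL₁ (Ls n) hn.1)).2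

/-- **Thm. 3.21 in the thermodynamic limit under Thm. 3.18's hypotheses** (`B = exp(NW)`, `w₁ = 1`,
`w_k ≥ 0`: then `b_k ≥ 0` is the tree's `fluctCoeff_nonneg_of_hasLog`). [cite: SalmhoferSeiler1991, Thm. 3.21 with Thm. 3.18 and Thm. 3.23 (1) (3.109)] -/
theorem thermodynamicLimit_infraredBound_of_hasLog (hν : 1 ≤ ν) {N : ℕ} (hN : 1 ≤ N)
    {a w : ℕ → ℝ} (hlog : HasLog N a w) (ha0 : a 0 = 1) (hw1 : w 1 = 1)
    (hw : ∀ k, 2 ≤ k → k ≤ N → 0 ≤ w k) {m : ℝ} (Ls : ℕ → ℕ) [∀ n, NeZero (Ls n)]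
    (hev : ∀ n, Even (Ls n)) (hLs : Tendsto Ls atTop atTop) {T : Site ν → ℝ}
    (hT : ∀ x, Tendsto (fun n => corrFn (L := Ls n) N m a (Torus.proj (Ls n) x)) atTop (nhds (T x)))
    (S : Finset (Site ν)) (φ : Site ν → ℝ) (hφ : ∀ x, x ∉ S → φ x = 0) :
    (∑ x ∈ nbhd S, ∑ y ∈ nbhd S, latStencil (-1) φ x * T (y - x) * latStencil (-1) φ y ≤
      1 / N * ∑ x ∈ S, φ x * latStencil (-1) φ x) ∧
    (-(1 / N * ∑ x ∈ S, φ x * latStencil 1 φ x) ≤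
      ∑ x ∈ nbhd S, ∑ y ∈ nbhd S, latStencil 1 φ x * T (y - x) * latStencil 1 φ y) :=
  thermodynamicLimit_infraredBound hν hN (fluctCoeff_nonneg_of_hasLog hlog ha0 hw1 hw) Ls hev hLs hT
    S φ hφ

/-- **The `U(N)` model, `1 ≤ N ≤ 4`**: the infrared bound for every thermodynamic limit of the
two-point function of the `β = 0` `U(N)` theory with staggered fermions (bosonised form).
[cite: SalmhoferSeiler1991, Thm. 3.21 with Remark 4.5/4.6] -/
theorem uN_thermodynamicLimit_infraredBound (hν : 1 ≤ ν) {N : ℕ} (hN1 : 1 ≤ N) (hN4 : N ≤ 4)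
    {m : ℝ} (Ls : ℕ → ℕ) [∀ n, NeZero (Ls n)]
    (hev : ∀ n, Even (Ls n)) (hLs : Tendsto Ls atTop atTop) {T : Site ν → ℝ}
    (hT : ∀ x, Tendsto (fun n => corrFn (L := Ls n) N m (uNBondCoeff N) (Torus.proj (Ls n) x))
      atTop (nhds (T x)))
    (S : Finset (Site ν)) (φ : Site ν → ℝ) (hφ : ∀ x, x ∉ S → φ x = 0) :
    (∑ x ∈ nbhd S, ∑ y ∈ nbhd S, latStencil (-1) φ x * T (y - x) * latStencil (-1) φ y ≤
      1 / N * ∑ x ∈ S, φ x * latStencil (-1) φ x) ∧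
    (-(1 / N * ∑ x ∈ S, φ x * latStencil 1 φ x) ≤
      ∑ x ∈ nbhd S, ∑ y ∈ nbhd S, latStencil 1 φ x * T (y - x) * latStencil 1 φ y) :=
  thermodynamicLimit_infraredBound_of_hasLog hν hN1 (hasLog_uN hN1 hN4) (uNBondCoeff_zero N)
    (uNLogCoeff_one N) (fun k hk2 hkN => uNLogCoeff_nonneg hN4 k hk2 hkN) Ls hev hLs hT S φ hφ

end ComplexSpin

end Literature.MathematicalPhysics.StatisticalMechanics

end
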